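import Mathlib
import HarnessLib
import Summits.NavierStokesRegularity.NavierStokesRegularity.Theses.RootDecompLitSlice
import Summits.NavierStokesRegularity.NavierStokesRegularity.Theorems.RootDecompLitSliceNoDarkBallStubNoGlobalExtinction

/-!
# RootDecompLitSlice — item `NoGlobalExtinction` (D₂, stmt-NavierStokesRegularity-29567) PROVED

**The terminal slice of a first blow-up is not globally extinct**: for a maximal smooth solution of
lifespan `T > 0` on `ℝ³` (viscosity `ν > 0`, zero force), Leray–Hopf on `[0, T]` from its rapidly
decaying datum, `u T` is not a.e. zero. The route decl `Theses.RootDecompLitSlice.NoGlobalExtinction`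
(aside D₂ = stub 2 of the birth skeleton of the crux `NoDarkBall`, stmt-NavierStokesRegularity-29563)
is literally the registered signature of `Theorems.NoDarkBall.stub_noGlobalExtinction`, landed in
`Theorems/RootDecompLitSliceNoDarkBallStubNoGlobalExtinction.lean` (weak `L²` continuity at `T` +
backward uniqueness for classical Leray–Hopf solutions, Lemarié-Rieusset 2016 Thm. 15.4 after
Escauriaza–Seregin–Šverák 2003, + continuation of bounded solutions); this file closes the item by name.
Alone it evicts every Navier–Stokes-inequality blow-up in print (all globally energy-extinct at the
singular time) from the route's dark cells. Navier–Stokes regularity is NOT proved by anything here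
(D₂ is an aside, outside the cone of `closes`). decomp-ns writer g13.
[cite: LemarieRieusset2016, Thm. 15.4 (p. 568)] [cite: EscauriazaSereginSverak2003, Thm. 1.4 and §5]
-/

-- the summit and its single sub-problem share the name (CONVENTIONS §1), as in every Theorems file
set_option linter.dupNamespace false

namespace Summit.NavierStokesRegularity.NavierStokesRegularity.Theorems.NoGlobalExtinction

/-- **Item `NoGlobalExtinction` (stmt-NavierStokesRegularity-29567) of route RootDecompLitSlice, by
name** — no global extinction at a first blow-up time. [cite: LemarieRieusset2016, Thm. 15.4 (p. 568)] -/
theorem noGlobalExtinction_proof : Theses.RootDecompLitSlice.NoGlobalExtinction :=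
  NoDarkBall.stub_noGlobalExtinction

end Summit.NavierStokesRegularity.NavierStokesRegularity.Theorems.NoGlobalExtinction
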